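import Literature.MathematicalPhysics.QuantumLattice.FreeCovariance
import Literature.MathematicalPhysics.QuantumLattice.RandomFieldProofs
import HarnessLib

/-!
# Second moments of the free Euclidean field: `∫ ω(f) ω(g) dμ = C_m(f, g)`

Sibling proof file of `FreeCovariance.lean` (theorems only). For the law `μ` of the free field of
mass `m ≠ 0` (`IsFreeField m μ`: a centred Gaussian measure on `𝒮'` with generating functional
`S(f) = exp (−½ C_m(f, f))`, Glimm–Jaffe §6.2 (6.2.2)/(6.2.10)) the covariance of the field is the
free covariance:

* `IsFreeField.integral_eval_sq` — `∫ ω(f)² dμ = C_m(f, f)`: compare the two expressions of the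
  generating functional, `exp (−½ ∫ ω(f)² dμ)` (centred Gaussian,
  `IsGaussianField.genFunctional_eq_holds`) and `exp (−½ C_m(f, f))`;
* `IsFreeField.integral_eval_mul_eval` — `∫ ω(f) ω(g) dμ = C_m(f, g)` by polarisation, using the
  bilinearity (`freeCovariance_add_left/right`, `m ≠ 0`) and symmetry of `C_m`;
* `IsFreeField.moment_two` — the same for the tree's `moment μ 2 ![f, g]`, the form consumed by
  `IsSchwingerFamilyOf` (the Schwinger two-point function of the free field is `C_m`;
  Glimm–Jaffe §6.2: "For Gaussian measures, `dφ` and `S₂` determine one another uniquely").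

## References

* J. Glimm, A. Jaffe, *Quantum Physics* (2nd ed. 1987), §6.2, (6.2.2) `S{f} = e^{−⟨f, Cf⟩/2}`,
  Prop. 6.2.2, and the uniqueness remark in the proof of Thm 6.2.4 (pdf pp. 94–96).
  [GlimmJaffeQP1987]
-/

noncomputable section

open scoped SchwartzMap ComplexConjugate FourierTransform
open MeasureTheory Complex Real

namespace Literature.MathematicalPhysics.QuantumLattice

/-! ### Bilinearity of the free covariance (`m ≠ 0`) -/

section Bilinear

variable {E : Type*} [NormedAddCommGroup E] [InnerProductSpace ℝ E] [FiniteDimensional ℝ E]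
  [MeasurableSpace E] [BorelSpace E]

/-- `C_m(f + f', g) = C_m(f, g) + C_m(f', g)` for `m ≠ 0` (additivity of the Bochner integral of
integrable integrands, `integrable_freeSymbol_mul`). [folklore] -/
theorem freeCovariance_add_left {m : ℝ} (hm : m ≠ 0) (f f' g : 𝓢(E, ℂ)) :
    freeCovariance m (f + f') g = freeCovariance m f g + freeCovariance m f' g := by
  unfold freeCovariance
  rw [← integral_add (integrable_freeSymbol_mul hm f g) (integrable_freeSymbol_mul hm f' g)]
  congr 1
  funext ξ
  rw [FourierTransform.fourier_add]
  show conj ((𝓕 f : 𝓢(E, ℂ)) ξ + (𝓕 f' : 𝓢(E, ℂ)) ξ) * _ * _ = _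
  rw [map_add]
  ring

/-- `C_m(f, g + g') = C_m(f, g) + C_m(f, g')` for `m ≠ 0`. [folklore] -/
theorem freeCovariance_add_right {m : ℝ} (hm : m ≠ 0) (f g g' : 𝓢(E, ℂ)) :
    freeCovariance m f (g + g') = freeCovariance m f g + freeCovariance m f g' := by
  unfold freeCovariance
  rw [← integral_add (integrable_freeSymbol_mul hm f g) (integrable_freeSymbol_mul hm f g')]
  congr 1
  funext ξ
  rw [FourierTransform.fourier_add]
  show _ * ((𝓕 g : 𝓢(E, ℂ)) ξ + (𝓕 g' : 𝓢(E, ℂ)) ξ) * _ = _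
  ring

/-- Additivity of the real free covariance in the first slot (`m ≠ 0`). [folklore] -/
theorem freeCovarianceReal_add_left {m : ℝ} (hm : m ≠ 0) (f f' g : 𝓢(E, ℝ)) :
    freeCovarianceReal m (f + f') g = freeCovarianceReal m f g + freeCovarianceReal m f' g := by
  unfold freeCovarianceReal
  rw [map_add, freeCovariance_add_left hm, Complex.add_re]

/-- Additivity of the real free covariance in the second slot (`m ≠ 0`). [folklore] -/
theorem freeCovarianceReal_add_right {m : ℝ} (hm : m ≠ 0) (f g g' : 𝓢(E, ℝ)) :
    freeCovarianceReal m f (g + g') = freeCovarianceReal m f g + freeCovarianceReal m f g' := by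
  unfold freeCovarianceReal
  rw [map_add, freeCovariance_add_right hm, Complex.add_re]

/-- The polarisation identity for the real free covariance (`m ≠ 0`):
`C_m(f + g, f + g) = C_m(f, f) + 2 C_m(f, g) + C_m(g, g)`. [folklore] -/
theorem freeCovarianceReal_add_self {m : ℝ} (hm : m ≠ 0) (f g : 𝓢(E, ℝ)) :
    freeCovarianceReal m (f + g) (f + g) =
      freeCovarianceReal m f f + 2 * freeCovarianceReal m f g + freeCovarianceReal m g g := by
  rw [freeCovarianceReal_add_left hm, freeCovarianceReal_add_right hm,
    freeCovarianceReal_add_right hm, freeCovarianceReal_comm m g f]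
  ring

end Bilinear

/-! ### The covariance of the free field -/

section Moments

variable {E : Type*} [NormedAddCommGroup E] [InnerProductSpace ℝ E] [FiniteDimensional ℝ E]
  [MeasurableSpace E] [BorelSpace E] {m : ℝ} {μ : Measure (FieldConfig E)}

/-- **The variance of the free field**: `∫ ω(f)² dμ = C_m(f, f)` for the law `μ` of the free field
of mass `m` (Glimm–Jaffe §6.2 (6.2.2): the generating functional `exp (−½⟨f, Cf⟩)` of the centred
Gaussian `dφ_C` is also `exp (−½ ∫ φ(f)² dφ_C)`, Prop. 6.2.2). [cite: GlimmJaffeQP1987, §6.2 (6.2.2)] -/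
theorem IsFreeField.integral_eval_sq (hμ : IsFreeField m μ) (f : 𝓢(E, ℝ)) :
    ∫ ω, (ω f) ^ 2 ∂μ = freeCovarianceReal m f f := by
  have h1 := IsGaussianField.genFunctional_eq_holds hμ.1 f
  have h2 := hμ.2 f
  rw [h1] at h2
  -- `exp (-a/2) = exp (-b/2)` with `a, b` real forces `a = b`
  have h3 : ((-(1 / 2 : ℝ) * ∫ ω, (ω f) ^ 2 ∂μ : ℝ) : ℂ) =
      ((-(1 / 2 : ℝ) * freeCovarianceReal m f f : ℝ) : ℂ) := by
    have e1 : cexp ((-(1 / 2 : ℝ) * ∫ ω, (ω f) ^ 2 ∂μ : ℝ) : ℂ) =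
        cexp ((-(1 / 2 : ℝ) * freeCovarianceReal m f f : ℝ) : ℂ) := by
      convert h2 using 2 <;> push_cast <;> ring
    rw [← Complex.ofReal_exp, ← Complex.ofReal_exp] at e1
    exact_mod_cast Real.exp_injective (Complex.ofReal_injective e1)
  have h4 : (-(1 / 2 : ℝ)) * ∫ ω, (ω f) ^ 2 ∂μ = (-(1 / 2 : ℝ)) * freeCovarianceReal m f f := by
    exact_mod_cast h3
  linarith

omit [FiniteDimensional ℝ E] [MeasurableSpace E] [BorelSpace E] in
/-- Under `HasAllMoments`, the product of two evaluations is integrable. [folklore] -/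
theorem HasAllMoments.integrable_eval_mul_eval (hmom : HasAllMoments μ) (f g : 𝓢(E, ℝ)) :
    Integrable (fun ω : FieldConfig E => ω f * ω g) μ := by
  have hf : MemLp (fun ω : FieldConfig E => ω f) 2 μ := by simpa using hmom 2 f
  have hg : MemLp (fun ω : FieldConfig E => ω g) 2 μ := by simpa using hmom 2 g
  exact hf.integrable_mul hg

omit [FiniteDimensional ℝ E] [MeasurableSpace E] [BorelSpace E] in
/-- Under `HasAllMoments`, the square of an evaluation is integrable. [folklore] -/
theorem HasAllMoments.integrable_eval_sq (hmom : HasAllMoments μ) (f : 𝓢(E, ℝ)) :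
    Integrable (fun ω : FieldConfig E => (ω f) ^ 2) μ := by
  simpa only [sq] using hmom.integrable_eval_mul_eval f f

/-- **The covariance of the free field is the free covariance**: `∫ ω(f) ω(g) dμ = C_m(f, g)` for
the law `μ` of the free field of mass `m ≠ 0` with all moments (polarisation of
`IsFreeField.integral_eval_sq`; Glimm–Jaffe §6.2, the covariance of `dφ_C` is `C`).
[cite: GlimmJaffeQP1987, §6.2 (6.2.2)] -/
theorem IsFreeField.integral_eval_mul_eval (hm : m ≠ 0) (hμ : IsFreeField m μ)
    (hmom : HasAllMoments μ) (f g : 𝓢(E, ℝ)) :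
    ∫ ω, ω f * ω g ∂μ = freeCovarianceReal m f g := by
  have hfg := hμ.integral_eval_sq (f + g)
  have hf := hμ.integral_eval_sq f
  have hg := hμ.integral_eval_sq g
  rw [freeCovarianceReal_add_self hm] at hfg
  have hexp : ∫ ω, (ω (f + g)) ^ 2 ∂μ =
      ∫ ω, (ω f) ^ 2 ∂μ + 2 * ∫ ω, ω f * ω g ∂μ + ∫ ω, (ω g) ^ 2 ∂μ := by
    have e : ∀ ω : FieldConfig E, (ω (f + g)) ^ 2 = (ω f) ^ 2 + 2 * (ω f * ω g) + (ω g) ^ 2 := by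
      intro ω
      rw [map_add]
      ring
    simp_rw [e]
    have i1 : Integrable (fun ω : FieldConfig E => ω f ^ 2) μ := hmom.integrable_eval_sq f
    have i2 : Integrable (fun ω : FieldConfig E => 2 * (ω f * ω g)) μ :=
      (hmom.integrable_eval_mul_eval f g).const_mul 2
    have i12 : Integrable (fun ω : FieldConfig E => ω f ^ 2 + 2 * (ω f * ω g)) μ := i1.add i2
    have i3 : Integrable (fun ω : FieldConfig E => ω g ^ 2) μ := hmom.integrable_eval_sq g
    rw [integral_add i12 i3, integral_add i1 i2, integral_const_mul]
  rw [hexp, hf, hg] at hfg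
  linarith

/-- **The Schwinger two-point function of the free field is `C_m`**: in the form consumed by
`IsSchwingerFamilyOf`, `moment μ 2 ![f, g] = ∫ ω(f) ω(g) dμ = C_m(f, g)` (`m ≠ 0`).
[cite: GlimmJaffeQP1987, §6.2 (6.2.2)] -/
theorem IsFreeField.moment_two (hm : m ≠ 0) (hμ : IsFreeField m μ) (hmom : HasAllMoments μ)
    (f g : 𝓢(E, ℝ)) : moment μ 2 ![f, g] = freeCovarianceReal m f g := by
  rw [← hμ.integral_eval_mul_eval hm hmom f g, moment]
  congr 1
  funext ω
  rw [Fin.prod_univ_two]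
  rfl

end Moments

end Literature.MathematicalPhysics.QuantumLattice
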